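/-
Copyright: the b2b-balaban cell (near-miss cell 7), T⁴-continuum fan-out; row NE7b ROUND-2 swarm, seat
t4-ne7b-formalise-leaf-05 gen 2 (row S6g′ binding of `t4/b2b-balaban-t4-ne7b-p1/LEAVES-NE7b.md`, owner's ruling R-OWNER-22-12 (2)).
Released under the licence of the surrounding project.
-/
import Summits.QuantumFields.BalabanUV.T4Continuum.Support.HistoryJoinsCount

/-!
# History joins, part 4: the TELESCOPED BOUND — canonical placements of a shape tree ≤ the product over its joins

Summits-side support leaf of the T⁴-continuum cell (rung (B)+1 on a FINITE torus only; NOT infinite volume, NOT the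
mass gap, NOT the Clay statement; NOT a proof of the spine estimate NE7b).  Row NE7b, route «COUNT»; row S6g′, the
binding, continued from `HistoryJoinsCount`.  [folklore] well-founded recursion over the lineage's own carrier with
the displayed zone data of parts 2–3; nothing is quoted from print, nothing printed is asserted, no `[cite:]` tag, no
`Prop` fact of Bałaban's.

WHAT.  **`jW`** — the product over the joins of `G` of `(Σ_j M t (part j))^{r−1} · ∏_{i ≠ host} NZ (ext t (part i)) t
(rootStep (part i)) ∕ ∏_classes k_g!`, defined by well-founded recursion along the top join (parts are strictly
smaller, `HistoryJoins.gsize_lt_of_mem_jparts`): `jW (born) = 1`, `jW (renew G) = jW G`,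
`jW (merge X Y e) = jfac X Y e · ∏_i jW (part i)`; and **`Wn_le_jW : Wn G ≤ jW G`** for EVERY `G` — part 3's recursive
inequality `Wn_merge_mul_symFac_le` telescoped (host split off the product, division by the symmetry factor).  So the
number of canonically admissible address placements of the shape tree with a given root cell is at most the product
over its joins of the per-join factors; their logarithms `(r−1)·log S_J + Σ_{i≠h} log NZ_i − Σ_g log k_g!` are the
summands of `HistorySiblingMassLayered.layered_cost_le_of_budget` (leaf-10 gen 2), with `S_J ≤ C·Q_t`,
`log NZ_i ≤ log Mρ(ext) + (t + 1 − rootStep (part i))·log Λ` and `Σ_joins Σ_{i≠h} (t+1−rootStep) = partnerAges`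
(`HistoryJoins.partnerAges_add_eq_sum_clusterParts`) — the class-linear conversion is the consumer's, as booked.

HONEST SCOPE.  As parts 2–3: displayed zone data, conditional laws; the torus instantiation is rows (a)(b) + S6 pt 3.
NE7b NOT proved.  HONEST DEPENDENCY (cell): continuum YM on T⁴ ⇐ BetaPertH ∧ nine spine estimates (0/9 proved);
BetaPertH ⇐ (D1) ∧ (D4) ∧ CAP+tail.  This file changes none of it.
-/

open Finset
open Literature.MathematicalPhysics.QuantumFieldTheory.Balaban1983to89
open T4PersistenceDictionary T4PartnerMultiplicity T4BranchingRecordsGas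
open Summit.QuantumFields.BalabanUV.T4Continuum.HistorySiblingSymmetry
open Summit.QuantumFields.BalabanUV.T4Continuum.HistorySiblingCanon
open Summit.QuantumFields.BalabanUV.T4Continuum.HistoryJoins
open Summit.QuantumFields.BalabanUV.T4Continuum.HistoryJoinsAdm
open Summit.QuantumFields.BalabanUV.T4Continuum.HistoryJoinsCount

namespace Summit.QuantumFields.BalabanUV.T4Continuum.HistoryJoinsTotal

noncomputable section

open scoped Classical

variable {ε γ β R : Type*} [DecidableEq β] [LinearOrder R] [Fintype γ] {D : ℕ}
  (zone : ℕ → Gen ε → (Addr D → γ) → Finset β) (ρ : (Addr D → γ) → R) (c₀ : γ) (st : ε → ℕ)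
  (M : ℕ → Gen ε → ℕ) (ext : ℕ → Gen ε → ℝ) (NZ : ℝ → ℕ → ℕ → ℕ)

/-! ## §1 The per-join factor and the product over the joins -/

/-- **THE PER-JOIN FACTOR** `(Σ_j M t (part j))^{r−1} · ∏_{i ≠ host} NZ_i ∕ symFac`. [folklore] -/
def jfac (X Y : Gen ε) (e : ε) : ℝ :=
  (∑ j, (M (st e) (part st (Gen.merge X Y e) j).2 : ℝ)) ^ (npart st (Gen.merge X Y e) - 1) *
      (∏ i : {i // i ≠ hostIdx st X Y e},
        (NZ (ext (st e) (part st (Gen.merge X Y e) i.1).2) (st e) (part st _ i.1).2.rootStep : ℝ)) /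
    symFac st X Y e

/-- the per-join factor is nonnegative [folklore] -/
theorem jfac_nonneg (X Y : Gen ε) (e : ε) : 0 ≤ jfac st M ext NZ X Y e :=
  div_nonneg (mul_nonneg (pow_nonneg (sum_nonneg fun _ _ => Nat.cast_nonneg _) _)
    (prod_nonneg fun _ _ => Nat.cast_nonneg _)) (symFac_pos st X Y e).le

/-- **THE PRODUCT OVER THE JOINS** (well-founded along the top join: the parts are strictly smaller). [folklore] -/
def jW : Gen ε → ℝ
  | Gen.born _ _ => 1
  | Gen.renew G _ _ => jW G
  | Gen.merge X Y e => jfac st M ext NZ X Y e * ∏ i : Fin (npart st (Gen.merge X Y e)), jW (part st (Gen.merge X Y e) i).2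
termination_by G => gsize G
decreasing_by
  · simp [gsize]
  · exact gsize_lt_of_mem_jparts st _ _ (part_mem st _ i)

/-- unfolding at a birth [folklore] -/
@[simp] theorem jW_born (b : ε) (j : ℕ) : jW st M ext NZ (Gen.born b j) = 1 := by
  rw [jW]

/-- unfolding at a renewal [folklore] -/
@[simp] theorem jW_renew (G : Gen ε) (e : ε) (h : ℕ) : jW st M ext NZ (Gen.renew G e h) = jW st M ext NZ G := by
  rw [jW]

/-- unfolding at a merger [folklore] -/
theorem jW_merge (X Y : Gen ε) (e : ε) :
    jW st M ext NZ (Gen.merge X Y e) =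
      jfac st M ext NZ X Y e * ∏ i : Fin (npart st (Gen.merge X Y e)), jW st M ext NZ (part st (Gen.merge X Y e) i).2 := by
  rw [jW]

/-- the product over the joins is nonnegative [folklore] -/
theorem jW_nonneg : ∀ G : Gen ε, 0 ≤ jW st M ext NZ G
  | Gen.born _ _ => by simp
  | Gen.renew G _ _ => by rw [jW_renew]; exact jW_nonneg G
  | Gen.merge X Y e => by
      rw [jW_merge]
      exact mul_nonneg (jfac_nonneg st M ext NZ X Y e) (prod_nonneg fun i _ => jW_nonneg (part st _ i).2)
termination_by G => gsize G
decreasing_by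
  · simp [gsize]
  · exact gsize_lt_of_mem_jparts st _ _ (part_mem st _ i)

/-! ## §2 The telescoped bound -/

/-- splitting the host off a product over the parts [folklore] -/
theorem prod_eq_host_mul {n : ℕ} (h : Fin n) (f : Fin n → ℝ) : ∏ i, f i = f h * ∏ i : {i // i ≠ h}, f i.1 := by
  rw [← Finset.prod_erase_mul univ f (mem_univ h), mul_comm]
  congr 1
  exact (Finset.prod_subtype (univ.erase h) (p := fun i => i ≠ h) (fun i => by simp) f)

/-- **THE TELESCOPED BOUND**: `Wn G ≤ jW G` for every shape tree `G`, under the displayed laws of part 3 (asked for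
admissible placements only). [folklore] -/
theorem Wn_le_jW (near : β → ℕ → γ → ℕ → ℝ → Prop)
    (hcard : ∀ (t : ℕ) (Z : Gen ε) (p : Addr D → γ), p ∈ Sany zone ρ c₀ st Z → (zone t Z p).card ≤ M t Z)
    (hloc : ∀ (t : ℕ) (Z : Gen ε) (p : Addr D → γ) (u : β), p ∈ Sany zone ρ c₀ st Z → u ∈ zone t Z p →
      near u t (evalA c₀ p (rootAddr Z)) Z.rootStep (ext t Z))
    (hNZ : ∀ (u : β) (t s : ℕ) (r : ℝ), (univ.filter fun y : γ => near u t y s r).card ≤ NZ r t s) :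
    ∀ G : Gen ε, (Wn zone ρ c₀ st G : ℝ) ≤ jW st M ext NZ G
  | Gen.born b j => by
      rw [jW_born]; exact_mod_cast Wn_born_le (zone := zone) (ρ := ρ) (c₀ := c₀) (st := st) b j
  | Gen.renew G e h => by
      rw [jW_renew, Wn_renew]; exact Wn_le_jW near hcard hloc hNZ G
  | Gen.merge X Y e => by
      have ih : ∀ i : Fin (npart st (Gen.merge X Y e)),
          (Wn zone ρ c₀ st (part st _ i).2 : ℝ) ≤ jW st M ext NZ (part st _ i).2 :=
        fun i => Wn_le_jW near hcard hloc hNZ (part st _ i).2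
      have hR := Wn_merge_mul_symFac_le (zone := zone) (ρ := ρ) (c₀ := c₀) (st := st) (X := X) (Y := Y) (e := e)
        M ext near NZ hcard hloc hNZ
      have hsym := symFac_pos st X Y e
      -- replace the widths of the parts by their bounds
      have hNZ0 : ∀ i : {i // i ≠ hostIdx st X Y e},
          (0 : ℝ) ≤ (NZ (ext (st e) (part st (Gen.merge X Y e) i.1).2) (st e)
            (part st (Gen.merge X Y e) i.1).2.rootStep : ℝ) :=
        fun _ => Nat.cast_nonneg _
      have hS : 0 ≤ (∑ j, (M (st e) (part st (Gen.merge X Y e) j).2 : ℝ)) ^ (npart st (Gen.merge X Y e) - 1) :=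
        pow_nonneg (sum_nonneg fun _ _ => Nat.cast_nonneg _) _
      have hstep : (Wn zone ρ c₀ st (part st (Gen.merge X Y e) (hostIdx st X Y e)).2 : ℝ) *
          ((∑ j, (M (st e) (part st (Gen.merge X Y e) j).2 : ℝ)) ^ (npart st (Gen.merge X Y e) - 1) *
            ∏ i : {i // i ≠ hostIdx st X Y e},
              ((NZ (ext (st e) (part st (Gen.merge X Y e) i.1).2) (st e)
                (part st (Gen.merge X Y e) i.1).2.rootStep : ℝ) *
                Wn zone ρ c₀ st (part st (Gen.merge X Y e) i.1).2)) ≤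
          jW st M ext NZ (part st (Gen.merge X Y e) (hostIdx st X Y e)).2 *
            ((∑ j, (M (st e) (part st (Gen.merge X Y e) j).2 : ℝ)) ^ (npart st (Gen.merge X Y e) - 1) *
              ∏ i : {i // i ≠ hostIdx st X Y e},
                ((NZ (ext (st e) (part st (Gen.merge X Y e) i.1).2) (st e)
                  (part st (Gen.merge X Y e) i.1).2.rootStep : ℝ) *
                  jW st M ext NZ (part st (Gen.merge X Y e) i.1).2)) := by
        refine mul_le_mul (ih _) (mul_le_mul_of_nonneg_left (prod_le_prod (fun i _ =>
          mul_nonneg (hNZ0 i) (Nat.cast_nonneg _)) fun i _ => mul_le_mul_of_nonneg_left (ih i.1) (hNZ0 i)) hS)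
          (mul_nonneg hS (prod_nonneg fun i _ => mul_nonneg (hNZ0 i) (Nat.cast_nonneg _)))
          (jW_nonneg st M ext NZ _)
      have hfin := hR.trans hstep
      -- reassemble: host × others = the product over all parts; divide by the symmetry factor
      rw [prod_mul_distrib] at hfin
      rw [← le_div_iff₀ hsym] at hfin
      rw [jW_merge, jfac, prod_eq_host_mul (hostIdx st X Y e) (fun i => jW st M ext NZ (part st (Gen.merge X Y e) i).2)]
      refine hfin.trans (le_of_eq ?_)
      ring
termination_by G => gsize G
decreasing_by
  · simp [gsize]
  · exact gsize_lt_of_mem_jparts st _ _ (part_mem st _ i)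

/-- **COROLLARY (the count the H3 price reading consumes)**: the canonically admissible junk placements of the shape
tree `G` with the root birth at the cell `z` number at most `jW G` — the product over the joins of `G` of
`(Σ_j M t (part j))^{r−1} · ∏_{i≠h} NZ_i ∕ ∏_g k_g!`. [folklore] -/
theorem card_S_le_jW (near : β → ℕ → γ → ℕ → ℝ → Prop)
    (hcard : ∀ (t : ℕ) (Z : Gen ε) (p : Addr D → γ), p ∈ Sany zone ρ c₀ st Z → (zone t Z p).card ≤ M t Z)
    (hloc : ∀ (t : ℕ) (Z : Gen ε) (p : Addr D → γ) (u : β), p ∈ Sany zone ρ c₀ st Z → u ∈ zone t Z p →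
      near u t (evalA c₀ p (rootAddr Z)) Z.rootStep (ext t Z))
    (hNZ : ∀ (u : β) (t s : ℕ) (r : ℝ), (univ.filter fun y : γ => near u t y s r).card ≤ NZ r t s)
    (G : Gen ε) (z : γ) : ((S zone ρ c₀ st G z).card : ℝ) ≤ jW st M ext NZ G :=
  le_trans (by exact_mod_cast card_S_le_Wn G z) (Wn_le_jW zone ρ c₀ st M ext NZ near hcard hloc hNZ G)

end

end Summit.QuantumFields.BalabanUV.T4Continuum.HistoryJoinsTotal
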